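import Summits.ValiantsHypothesis.ValiantsHypothesis.Theorems.NewtonUnitEquationsTwoProductsConfinedTameLawCircuits
import Summits.ValiantsHypothesis.ValiantsHypothesis.Theorems.NewtonUnitEquationsTwoProductsFormalLogLinearisationDefs

/-!
# R10 (`positive-circuit-chart`) — part 2/3: the CHART of a relation lattice `Λ ≤ ℤ^ι` over `ℚ`
`Vof F Λ = Λ^⊥`; integer circuits, `circuitSupports`, `atom` (one integer circuit per circuit support); every rational circuit is
a positive multiple of an atom; positive combinations of circuits are nonnegative combinations of atoms; the planar rows
`σ_c` and `w = σ₀ + σ₁ > 0` lie in the cone; (i) every letter meets an atom; (ii) planar rows are nonnegative rational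
combinations of atoms; (iii) the integer vectors orthogonal to all atoms are exactly the saturation of `Λ` (double orthogonal
complement for the dot product over `ℚ`).  R275 P3 scope: a TOOL for the proper positive sub-case rung R10 `ConfinedTameLaw` (val-idea-37 `positive-circuit-chart`);
nothing here closes 5906 (`TwoProducts` / `ResidualLawV21` / `PlanarCellBound` remain OPEN); VP ≠ VNP is NOT proved.
-/

set_option linter.dupNamespace false
set_option linter.unusedSectionVars false

/-! ## F2 — the chart for a relation lattice `Λ ≤ ℤ^ι`: atoms = integer positive circuits of `Λ^⊥ ∩ F^ι_{≥0}` -/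

namespace Summit.ValiantsHypothesis.ValiantsHypothesis.Theorems.NewtonUnitEquations.TwoProducts.PermutationType.R10

open scoped BigOperators

section Chart
variable {ι : Type*} [Fintype ι] [DecidableEq ι]

/-- The orthogonal space `Λ^⊥` of an integer lattice over a field `F`. [folklore] -/
def Vof (F : Type*) [Field F] (Λ : Submodule ℤ (ι → ℤ)) : Submodule F (ι → F) where
  carrier := {y | ∀ z ∈ Λ, ∑ i, (z i : F) * y i = 0}
  add_mem' := by
    intro a b ha hb z hz
    simp only [Pi.add_apply, mul_add, Finset.sum_add_distrib, ha z hz, hb z hz, add_zero]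
  zero_mem' := by intro z hz; simp
  smul_mem' := by
    intro c x hx z hz
    simp only [Pi.smul_apply, smul_eq_mul]
    have : ∑ i, (z i : F) * (c * x i) = c * ∑ i, (z i : F) * x i := by
      rw [Finset.mul_sum]; exact Finset.sum_congr rfl fun i _ => by ring
    rw [this, hx z hz, mul_zero]

/-- Membership in `Λ^⊥`. [folklore] -/
theorem mem_Vof {F : Type*} [Field F] (Λ : Submodule ℤ (ι → ℤ)) (y : ι → F) :
    y ∈ Vof F Λ ↔ ∀ z ∈ Λ, ∑ i, (z i : F) * y i = 0 := Iff.rfl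

variable (Λ : Submodule ℤ (ι → ℤ))

/-- Cast of a natural vector. [folklore] -/
def castN (F : Type*) [Field F] (q : ι → ℕ) : ι → F := fun i => (q i : F)

/-- An INTEGER (natural) circuit of `Λ^⊥ ∩ ℚ^ι_{≥0}` with prescribed support. [folklore] -/
def IsIntCircuit (S : Finset ι) (q : ι → ℕ) : Prop := IsCircuit (Vof ℚ Λ) (castN ℚ q) ∧ fsupp (castN ℚ q) = S

/-- The supports of integer circuits. [folklore] -/
noncomputable def circuitSupports : Finset (Finset ι) := by
  classical exact Finset.univ.filter fun S => ∃ q : ι → ℕ, IsIntCircuit Λ S q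

/-- Membership in the circuit supports. [folklore] -/
theorem mem_circuitSupports (S : Finset ι) : S ∈ circuitSupports Λ ↔ ∃ q : ι → ℕ, IsIntCircuit Λ S q := by
  unfold circuitSupports; simp

/-- **Rational circuits have integer representatives**: scaling by the product of the denominators. [folklore] -/
theorem exists_intCircuit_of_circuit {c : ι → ℚ} (hc : IsCircuit (Vof ℚ Λ) c) :
    ∃ q : ι → ℕ, IsIntCircuit Λ (fsupp c) q ∧ ∃ t : ℚ, 0 < t ∧ castN ℚ q = t • c := by
  classical
  set d : ℕ := ∏ i, (c i).den with hd
  have hdpos : 0 < d := Finset.prod_pos fun i _ => (c i).den_pos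
  have hdvd : ∀ i, (c i).den ∣ d := fun i => Finset.dvd_prod_of_mem _ (Finset.mem_univ i)
  -- the scaled vector has natural entries
  have hint : ∀ i, ∃ n : ℕ, (n : ℚ) = d * c i := by
    intro i
    have hci : 0 ≤ c i := hc.1.2 i
    obtain ⟨k, hk⟩ := hdvd i
    have hnum : 0 ≤ (c i).num := Rat.num_nonneg.mpr hci
    refine ⟨k * (c i).num.toNat, ?_⟩
    have e1 : ((c i).num.toNat : ℚ) = ((c i).num : ℚ) := by
      have := Int.toNat_of_nonneg hnum; exact_mod_cast this
    rw [Nat.cast_mul, e1, hk, Nat.cast_mul]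
    have hden : ((c i).den : ℚ) ≠ 0 := by exact_mod_cast (c i).den_pos.ne'
    calc (k : ℚ) * ((c i).num : ℚ) = (k : ℚ) * (((c i).num : ℚ) / ((c i).den : ℚ) * ((c i).den : ℚ)) := by
          rw [div_mul_cancel₀ _ hden]
      _ = (k : ℚ) * (c i * ((c i).den : ℚ)) := by rw [Rat.num_div_den]
      _ = ((c i).den : ℚ) * (k : ℚ) * c i := by ring
  choose q hq using hint
  have hcast : castN ℚ q = (d : ℚ) • c := by funext i; simp only [castN, hq, Pi.smul_apply, smul_eq_mul]
  have hdq : (0 : ℚ) < d := by exact_mod_cast hdpos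
  have hsupp : fsupp (castN ℚ q) = fsupp c := by
    ext i; rw [mem_fsupp, mem_fsupp, hcast]; simp [hdq.ne']
  have hK : InCone (Vof ℚ Λ) (castN ℚ q) := by rw [hcast]; exact inCone_smul _ hc.1 hdq.le
  refine ⟨q, ⟨⟨hK, by rw [hcast]; exact smul_ne_zero hdq.ne' hc.2.1, fun y hy hy0 hsub => ?_⟩, hsupp⟩, d, hdq, hcast⟩
  rw [hsupp] at hsub ⊢; exact hc.2.2 y hy hy0 hsub

/-- The chosen integer circuit on a circuit support. [folklore] -/
noncomputable def atomOf (S : Finset ι) (hS : S ∈ circuitSupports Λ) : ι → ℕ :=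
  Classical.choose ((mem_circuitSupports Λ S).1 hS)

/-- Its defining property. [folklore] -/
theorem atomOf_spec (S : Finset ι) (hS : S ∈ circuitSupports Λ) : IsIntCircuit Λ S (atomOf Λ S hS) :=
  Classical.choose_spec ((mem_circuitSupports Λ S).1 hS)

/-- The number of atoms. [folklore] -/
noncomputable def nAtoms : ℕ := (circuitSupports Λ).card

/-- The `a`-th atom (an integer circuit). [folklore] -/
noncomputable def atom (a : Fin (nAtoms Λ)) : ι → ℕ :=
  atomOf Λ ((circuitSupports Λ).equivFin.symm a).1 ((circuitSupports Λ).equivFin.symm a).2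

/-- Each atom is an integer circuit supported on its index support. [folklore] -/
theorem atom_spec (a : Fin (nAtoms Λ)) : IsIntCircuit Λ ((circuitSupports Λ).equivFin.symm a).1 (atom Λ a) :=
  atomOf_spec Λ _ _

/-- **Every rational circuit is a positive multiple of an atom.** [folklore] -/
theorem exists_atom_of_circuit {c : ι → ℚ} (hc : IsCircuit (Vof ℚ Λ) c) :
    ∃ a : Fin (nAtoms Λ), ∃ t : ℚ, 0 < t ∧ c = t • castN ℚ (atom Λ a) := by
  classical
  obtain ⟨q, hq, -, -, -⟩ := exists_intCircuit_of_circuit Λ hc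
  have hS : fsupp c ∈ circuitSupports Λ := (mem_circuitSupports Λ _).2 ⟨q, hq⟩
  set a : Fin (nAtoms Λ) := (circuitSupports Λ).equivFin ⟨fsupp c, hS⟩ with ha
  have hidx : ((circuitSupports Λ).equivFin.symm a).1 = fsupp c := by rw [ha, Equiv.symm_apply_apply]
  have hat := atom_spec Λ a
  rw [hidx] at hat
  obtain ⟨t, ht, hct⟩ := circuit_unique (Vof ℚ Λ) hc hat.1 hat.2.symm
  exact ⟨a, t, ht, hct⟩

/-- **Positive combinations of circuits are nonnegative combinations of atoms.** [folklore] -/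
theorem exists_coeffs_of_list (l : List (ℚ × (ι → ℚ))) (hl : ∀ p ∈ l, 0 < p.1 ∧ IsCircuit (Vof ℚ Λ) p.2) :
    ∃ g : Fin (nAtoms Λ) → ℚ, (∀ a, 0 ≤ g a) ∧ (l.map fun p => p.1 • p.2).sum = ∑ a, g a • castN ℚ (atom Λ a) := by
  classical
  induction l with
  | nil => exact ⟨fun _ => 0, fun _ => le_rfl, by simp⟩
  | cons p l ih =>
    obtain ⟨g, hg, hsum⟩ := ih (fun p' hp' => hl p' (List.mem_cons_of_mem _ hp'))
    obtain ⟨hp1, hp2⟩ := hl p (by simp)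
    obtain ⟨a, t, ht, hpt⟩ := exists_atom_of_circuit Λ hp2
    refine ⟨g + Pi.single a (p.1 * t), fun b => ?_, ?_⟩
    · simp only [Pi.add_apply]
      by_cases hb : b = a
      · subst hb; simp only [Pi.single_eq_same]; exact add_nonneg (hg b) (mul_pos hp1 ht).le
      · rw [Pi.single_eq_of_ne hb, add_zero]; exact hg b
    · rw [List.map_cons, List.sum_cons, hsum, hpt]
      simp only [Pi.add_apply, add_smul, Finset.sum_add_distrib]
      rw [add_comm]
      congr 1
      rw [Finset.sum_eq_single a (fun b _ hb => by rw [Pi.single_eq_of_ne hb, zero_smul]) (fun h => absurd (Finset.mem_univ a) h),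
        Pi.single_eq_same, smul_smul]

end Chart

end Summit.ValiantsHypothesis.ValiantsHypothesis.Theorems.NewtonUnitEquations.TwoProducts.PermutationType.R10


/-! ## F2b — the chart theorem (`PositiveCircuitChart` of val-idea-37's `Sketch.lean`, verbatim statement) -/

namespace Summit.ValiantsHypothesis.ValiantsHypothesis.Theorems.NewtonUnitEquations.TwoProducts.PermutationType.R10

open scoped BigOperators
open Summit.ValiantsHypothesis.ValiantsHypothesis.Theorems.NewtonUnitEquations.TwoProducts.FormalLogLinearisation (Expo)

/-- A nonnegative rational whose denominator divides `D` becomes a natural after multiplication by `D`. [folklore] -/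
theorem exists_nat_eq_mul_of_den_dvd (q : ℚ) (hq : 0 ≤ q) (D : ℕ) (hD : q.den ∣ D) : ∃ n : ℕ, (n : ℚ) = D * q := by
  obtain ⟨k, hk⟩ := hD
  have hnum : 0 ≤ q.num := Rat.num_nonneg.mpr hq
  refine ⟨k * q.num.toNat, ?_⟩
  have e1 : (q.num.toNat : ℚ) = (q.num : ℚ) := by have := Int.toNat_of_nonneg hnum; exact_mod_cast this
  have hden : (q.den : ℚ) ≠ 0 := by exact_mod_cast q.den_pos.ne'
  rw [Nat.cast_mul, e1, hk, Nat.cast_mul]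
  calc (k : ℚ) * (q.num : ℚ) = (k : ℚ) * ((q.num : ℚ) / (q.den : ℚ) * (q.den : ℚ)) := by rw [div_mul_cancel₀ _ hden]
    _ = (k : ℚ) * (q * (q.den : ℚ)) := by rw [Rat.num_div_den]
    _ = (q.den : ℚ) * (k : ℚ) * q := by ring

section ChartMain
variable {ι : Type*} [Fintype ι] [DecidableEq ι] (Λ : Submodule ℤ (ι → ℤ))

/-- The planar coordinate rows `σ_c = (e_i(c))_i` lie in the cone `Λ^⊥ ∩ ℚ^ι_{≥0}`. [folklore] -/
theorem sigma_inCone (e : ι → Expo) (hΛ : ∀ z ∈ Λ, ∀ c : Fin 2, ∑ i, z i * ((e i) c : ℤ) = 0) (c : Fin 2) :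
    InCone (Vof ℚ Λ) (fun i => ((e i) c : ℚ)) := by
  refine ⟨fun z hz => ?_, fun i => by positivity⟩
  have h := hΛ z hz c
  have h' : ((∑ i, z i * ((e i) c : ℤ) : ℤ) : ℚ) = 0 := by rw [h]; simp
  simpa [Int.cast_sum, Int.cast_mul] using h'

/-- The strictly positive row `w = σ₀ + σ₁` (letters are nonzero). [folklore] -/
theorem w_inCone (e : ι → Expo) (he : ∀ i, e i ≠ 0) (hΛ : ∀ z ∈ Λ, ∀ c : Fin 2, ∑ i, z i * ((e i) c : ℤ) = 0) :
    InCone (Vof ℚ Λ) (fun i => ((e i) 0 : ℚ) + ((e i) 1 : ℚ)) ∧ ∀ i, (0 : ℚ) < ((e i) 0 : ℚ) + ((e i) 1 : ℚ) := by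
  have h0 := sigma_inCone Λ e hΛ 0
  have h1 := sigma_inCone Λ e hΛ 1
  refine ⟨?_, fun i => ?_⟩
  · have := inCone_add (Vof ℚ Λ) h0 h1
    exact this
  · have hne : ∃ c, (e i) c ≠ 0 := by
      by_contra h; push Not at h; exact he i (Finsupp.ext fun c => by simpa using h c)
    obtain ⟨c, hc⟩ := hne
    have hc' : 0 < (e i) c := Nat.pos_of_ne_zero hc
    fin_cases c
    · have : (0 : ℚ) < ((e i) 0 : ℚ) := by exact_mod_cast hc'
      positivity
    · have : (0 : ℚ) < ((e i) 1 : ℚ) := by exact_mod_cast hc'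
      positivity

/-- (i) of the chart: every letter meets an atom. [folklore] -/
theorem exists_atom_ne_zero (e : ι → Expo) (he : ∀ i, e i ≠ 0) (hΛ : ∀ z ∈ Λ, ∀ c : Fin 2, ∑ i, z i * ((e i) c : ℤ) = 0)
    (i : ι) : ∃ a : Fin (nAtoms Λ), atom Λ a i ≠ 0 := by
  classical
  obtain ⟨hw, hwpos⟩ := w_inCone Λ e he hΛ
  have hi : i ∈ fsupp (fun i => ((e i) 0 : ℚ) + ((e i) 1 : ℚ)) := (mem_fsupp _ _).2 (hwpos i).ne'
  obtain ⟨c, hc, -, hic⟩ := exists_circuit_mem_fsupp (Vof ℚ Λ) hw hi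
  obtain ⟨a, t, ht, hct⟩ := exists_atom_of_circuit Λ hc
  refine ⟨a, fun h0 => ?_⟩
  rw [mem_fsupp, hct] at hic
  apply hic
  simp [castN, h0]

/-- (ii) of the chart: the planar rows are nonnegative rational combinations of the atoms. [folklore] -/
theorem exists_planar_coeffs (e : ι → Expo) (hΛ : ∀ z ∈ Λ, ∀ c : Fin 2, ∑ i, z i * ((e i) c : ℤ) = 0) (c : Fin 2) :
    ∃ g : Fin (nAtoms Λ) → ℚ, (∀ a, 0 ≤ g a) ∧ ∀ i, ((e i) c : ℚ) = ∑ a, g a * (atom Λ a i : ℚ) := by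
  classical
  have hσ := sigma_inCone Λ e hΛ c
  obtain ⟨l, hl, hsum⟩ := conformal_decomposition (Vof ℚ Λ) _ (fun i => ((e i) c : ℚ)) le_rfl hσ
  obtain ⟨g, hg, hgsum⟩ := exists_coeffs_of_list Λ l (fun p hp => ⟨(hl p hp).1, (hl p hp).2.1⟩)
  refine ⟨g, hg, fun i => ?_⟩
  have := congrFun (hsum.trans hgsum) i
  simp only [Finset.sum_apply, Pi.smul_apply, smul_eq_mul, castN] at this
  exact this

end ChartMain

end Summit.ValiantsHypothesis.ValiantsHypothesis.Theorems.NewtonUnitEquations.TwoProducts.PermutationType.R10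


/-! ## F2c — (iii): the integer kernel of the chart is the saturation of `Λ` -/

namespace Summit.ValiantsHypothesis.ValiantsHypothesis.Theorems.NewtonUnitEquations.TwoProducts.PermutationType.R10

open scoped BigOperators
open Summit.ValiantsHypothesis.ValiantsHypothesis.Theorems.NewtonUnitEquations.TwoProducts.FormalLogLinearisation (Expo)

section Kernel
variable {ι : Type*} [Fintype ι] [DecidableEq ι] (Λ : Submodule ℤ (ι → ℤ))

/-- Cast of an integer vector to `ℚ`. [folklore] -/
def castZ (z : ι → ℤ) : ι → ℚ := fun i => (z i : ℚ)

/-- Atoms lie in `Λ^⊥`. [folklore] -/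
theorem atom_mem_V (a : Fin (nAtoms Λ)) : castN ℚ (atom Λ a) ∈ Vof ℚ Λ := (atom_spec Λ a).1.1.1

/-- (iii, ⇐): saturated lattice vectors are orthogonal to every atom. [folklore] -/
theorem ortho_atom_of_sat (z : ι → ℤ) (k : ℕ) (hk : 0 < k) (hz : (fun i => (k : ℤ) * z i) ∈ Λ) (a : Fin (nAtoms Λ)) :
    ∑ i, z i * (atom Λ a i : ℤ) = 0 := by
  have h := (mem_Vof Λ _).1 (atom_mem_V Λ a) _ hz
  simp only [castN, Int.cast_mul, Int.cast_natCast] at h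
  have h2 : (k : ℚ) * ∑ i, (z i : ℚ) * (atom Λ a i : ℚ) = 0 := by
    rw [Finset.mul_sum]; rw [← h]; exact Finset.sum_congr rfl fun i _ => by ring
  have hk' : (k : ℚ) ≠ 0 := by exact_mod_cast hk.ne'
  have h3 : ∑ i, (z i : ℚ) * (atom Λ a i : ℚ) = 0 := by
    rcases mul_eq_zero.1 h2 with h | h
    · exact absurd h hk'
    · exact h
  exact_mod_cast h3

/-- A rational vector orthogonal to every atom is orthogonal to `Λ^⊥`. [folklore] -/
theorem ortho_V_of_ortho_atoms (e : ι → Expo) (he : ∀ i, e i ≠ 0) (hΛ : ∀ z ∈ Λ, ∀ c : Fin 2, ∑ i, z i * ((e i) c : ℤ) = 0)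
    (y : ι → ℚ) (hy : ∀ a : Fin (nAtoms Λ), ∑ i, y i * (atom Λ a i : ℚ) = 0) : ∀ v ∈ Vof ℚ Λ, ∑ i, y i * v i = 0 := by
  obtain ⟨hw, hwpos⟩ := w_inCone Λ e he hΛ
  refine ortho_of_ortho_circuits (Vof ℚ Λ) hw hwpos y fun c hc => ?_
  obtain ⟨a, t, ht, hct⟩ := exists_atom_of_circuit Λ hc
  rw [hct]
  simp only [Pi.smul_apply, smul_eq_mul, castN]
  have : ∑ i, y i * (t * (atom Λ a i : ℚ)) = t * ∑ i, y i * (atom Λ a i : ℚ) := by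
    rw [Finset.mul_sum]; exact Finset.sum_congr rfl fun i _ => by ring
  rw [this, hy a, mul_zero]

/-- The rational span of `Λ`. [folklore] -/
def spanQ : Submodule ℚ (ι → ℚ) := Submodule.span ℚ (castZ '' (Λ : Set (ι → ℤ)))

/-- Elements of the rational span of `Λ` have a positive integer multiple in `Λ`. [folklore] -/
theorem exists_nsmul_mem_of_mem_spanQ {x : ι → ℚ} (hx : x ∈ spanQ Λ) :
    ∃ k : ℕ, 0 < k ∧ ∃ l ∈ Λ, (k : ℚ) • x = castZ l := by
  unfold spanQ at hx
  induction hx using Submodule.span_induction with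
  | mem x hx =>
    obtain ⟨l, hl, rfl⟩ := hx
    exact ⟨1, one_pos, l, hl, by simp⟩
  | zero => exact ⟨1, one_pos, 0, Λ.zero_mem, by simp; rfl⟩
  | add x y _ _ hx hy =>
    obtain ⟨k₁, hk₁, l₁, hl₁, h₁⟩ := hx
    obtain ⟨k₂, hk₂, l₂, hl₂, h₂⟩ := hy
    refine ⟨k₁ * k₂, Nat.mul_pos hk₁ hk₂, (k₂ : ℤ) • l₁ + (k₁ : ℤ) • l₂, Λ.add_mem (Λ.smul_mem _ hl₁) (Λ.smul_mem _ hl₂), ?_⟩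
    funext i
    have e₁ := congrFun h₁ i; have e₂ := congrFun h₂ i
    simp only [Pi.smul_apply, smul_eq_mul, castZ] at e₁ e₂
    simp only [Pi.smul_apply, Pi.add_apply, smul_eq_mul, castZ, Int.cast_add, Int.cast_mul, Int.cast_natCast,
      Nat.cast_mul]
    rw [mul_add, show (k₁ : ℚ) * k₂ * x i = k₂ * (k₁ * x i) by ring, e₁, show (k₁ : ℚ) * k₂ * y i = k₁ * (k₂ * y i) by ring, e₂]
  | smul q x _ hx =>
    obtain ⟨k, hk, l, hl, h⟩ := hx
    refine ⟨k * q.den, Nat.mul_pos hk q.den_pos, q.num • l, Λ.smul_mem _ hl, ?_⟩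
    funext i
    have e := congrFun h i
    simp only [Pi.smul_apply, smul_eq_mul, castZ] at e
    simp only [Pi.smul_apply, smul_eq_mul, castZ, Int.cast_mul, Nat.cast_mul]
    have hqd : (q.den : ℚ) * q = (q.num : ℚ) := Rat.den_mul_eq_num q
    calc (k : ℚ) * (q.den : ℚ) * (q * x i) = ((q.den : ℚ) * q) * ((k : ℚ) * x i) := by ring
      _ = (q.num : ℚ) * (l i : ℚ) := by rw [e, hqd]

/-- (iii, ⇒): an integer vector orthogonal to every atom has a positive multiple in `Λ`
(double orthogonal complement for the dot product over `ℚ`). [folklore] -/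
theorem mem_sat_of_ortho_atoms (e : ι → Expo) (he : ∀ i, e i ≠ 0) (hΛ : ∀ z ∈ Λ, ∀ c : Fin 2, ∑ i, z i * ((e i) c : ℤ) = 0)
    (z : ι → ℤ) (hz : ∀ a : Fin (nAtoms Λ), ∑ i, z i * (atom Λ a i : ℤ) = 0) :
    ∃ k : ℕ, 0 < k ∧ (fun i => (k : ℤ) * z i) ∈ Λ := by
  classical
  -- orthogonality to Λ^⊥ over ℚ
  have hzQ : ∀ a : Fin (nAtoms Λ), ∑ i, castZ z i * (atom Λ a i : ℚ) = 0 := fun a => by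
    have := hz a; unfold castZ; exact_mod_cast this
  have hV := ortho_V_of_ortho_atoms Λ e he hΛ (castZ z) hzQ
  -- the dot product as a nondegenerate reflexive bilinear form
  set B : LinearMap.BilinForm ℚ (ι → ℚ) := Matrix.toBilin' (1 : Matrix ι ι ℚ) with hB
  have hBapp : ∀ x y : ι → ℚ, B x y = ∑ i, x i * y i := fun x y => by
    rw [hB, Matrix.toBilin'_apply', Matrix.one_mulVec]; rfl
  have hBnd : B.Nondegenerate := by
    rw [hB]; exact (Matrix.nondegenerate_of_det_ne_zero (by simp)).toBilin'
  have hBrefl : B.IsRefl := fun x y h => by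
    rw [hBapp] at h ⊢; rw [← h]; exact Finset.sum_congr rfl fun i _ => mul_comm _ _
  -- castZ z ∈ (Λ_ℚ^⊥)^⊥
  have hmem : castZ z ∈ B.orthogonal (B.orthogonal (spanQ Λ)) := by
    rw [LinearMap.BilinForm.mem_orthogonal_iff]
    intro n hn
    rw [LinearMap.BilinForm.mem_orthogonal_iff] at hn
    have hnV : n ∈ Vof ℚ Λ := by
      rw [mem_Vof]
      intro z' hz'
      have := hn (castZ z') (Submodule.subset_span ⟨z', hz', rfl⟩)
      rw [hBapp] at this; exact this
    have := hV n hnV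
    show B n (castZ z) = 0
    rw [hBapp, ← this]; exact Finset.sum_congr rfl fun i _ => mul_comm _ _
  rw [LinearMap.BilinForm.orthogonal_orthogonal hBnd hBrefl] at hmem
  obtain ⟨k, hk, l, hl, hkl⟩ := exists_nsmul_mem_of_mem_spanQ Λ hmem
  refine ⟨k, hk, ?_⟩
  have : (fun i => (k : ℤ) * z i) = l := by
    funext i
    have := congrFun hkl i
    simp only [Pi.smul_apply, smul_eq_mul, castZ] at this
    exact_mod_cast this
  rw [this]; exact hl

end Kernel

end Summit.ValiantsHypothesis.ValiantsHypothesis.Theorems.NewtonUnitEquations.TwoProducts.PermutationType.R10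


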